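import Literature.Geometry.Kaehler.ComplexTorusHodgeClasses
import Literature.Geometry.Kaehler.ComplexTorusMaps
import HarnessLib

/-!
# Reindexing the lattice basis of a complex torus: `integralForms`, `rationalForms`, `hodgeClasses`
# depend only on the lattice

Layer `Literature/Geometry/Kaehler`, namespace `Literature.Geometry.Kaehler.ComplexTorus`; lane
`lit-hodgefound`, row P-pre-28 (A1/A4 glue), supplement. The tree presents a complex torus `X = E/Λ` by a
period isomorphism `Φ : ℝ^ι ≃ E` (`Λ = Φ(ℤ^ι)`, i.e. a `ℤ`-basis `λᵢ = Φ(eᵢ)` of `Λ`); the concrete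
cohomological structures of `ComplexTorusHodgeClasses.lean` (`integralForms Φ k = Hᵏ(X, ℤ)`,
`rationalForms Φ k = Hᵏ(X, ℚ)`, `hodgeClasses Φ p` inside `Alt^k_ℝ(E; ℂ)`) are defined by integrality /
rationality of the periods on lattice tuples and therefore depend only on the lattice `Λ`, not on the
basis (Lange 2023, §1.1.1: "a lattice `Λ` in `V` is a discrete subgroup of maximal rank"; §1.1.3
Lemma 1.1.17 `Hⁿ(X, ℤ) = Altⁿ(Λ, ℤ)`). This file records that invariance and the REINDEXING of a
presentation along a bijection of index types `e : ι ≃ ι'` (so that results proved for `Fin n`-indexed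
presentations — `ComplexTorusIntegralComparison.lean`, where `ComplexTorus Φ` must literally be
`(ℝ/ℤ)ⁿ` — transfer to arbitrary finite index types, e.g. the product presentations `prodPeriod` on
`ι₁ ⊕ ι₂`).

## Contents (one definition with body; theorems; no named fact)

* `integralForms_eq_of_range_latticeVec_eq`, `rationalForms_eq_…`, `hodgeClassesIn_eq_…`,
  `hodgeClasses_eq_…` — two presentations with the same lattice `range (latticeVec Φ)` have the same
  `Hᵏ(X, ℤ)`, `Hᵏ(X, ℚ)`, `H^{2p}_Hodge(X)`;
* `ComplexTorus.reindex Φ e : (ι' → ℝ) ≃L[ℝ] E`, `v ↦ Φ (v ∘ e)` — the same lattice basis indexed by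
  `ι'` (`reindex_apply`, `latticeVec_reindex`, `range_latticeVec_reindex`, hence `integralForms_reindex`,
  `rationalForms_reindex`, `hodgeClasses_reindex`);
* `reindexMatrix e`, `reindexMatrixInv e` — the permutation matrices between the two presentations, with
  TRIVIAL analytic representation: `realRep Φ (reindex Φ e) (reindexMatrix e) = id`,
  `realRep (reindex Φ e) Φ (reindexMatrixInv e) = id` (Lange 2023, §1.1.2: `ρₐ`, `ρᵣ` of a
  homomorphism; here the homomorphism `mapMatrix` is the identity of `E/Λ` read in two coordinate
  systems).

## References

* [Lange2023AbelianVarietiesComplex] H. Lange, *Abelian Varieties over the Complex Numbers* (2023),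
  §1.1.1 (lattices, period matrices), §1.1.2 (rational and analytic representations), §1.1.3 Lemma 1.1.17.
-/

noncomputable section

open Function Set

namespace Literature.Geometry.Kaehler

namespace ComplexTorus

/-! ### The concrete structures depend only on the lattice -/

section Lattice

variable {ι ι' : Type*} {E : Type*} [NormedAddCommGroup E] [NormedSpace ℂ E]
  {Φ : (ι → ℝ) ≃L[ℝ] E} {Φ' : (ι' → ℝ) ≃L[ℝ] E}

/-- If the lattice of `Φ'` lies in the lattice of `Φ`, forms integral on `Φ`-lattice tuples are integral on
`Φ'`-lattice tuples. [cite: Lange2023AbelianVarietiesComplex, §1.1.3 Lemma 1.1.17] -/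
theorem integralForms_le_of_range_latticeVec_subset
    (h : range (latticeVec Φ') ⊆ range (latticeVec Φ)) (k : ℕ) :
    integralForms Φ k ≤ integralForms Φ' k := by
  intro γ hγ m'
  choose m hm using fun j ↦ h ⟨m' j, rfl⟩
  obtain ⟨z, hz⟩ := hγ m
  refine ⟨z, ?_⟩
  rw [← hz]
  congr 1
  funext j
  rw [latticeTuple_apply, latticeTuple_apply, hm j]

/-- If the lattice of `Φ'` lies in the lattice of `Φ`, forms rational on `Φ`-lattice tuples are rational on
`Φ'`-lattice tuples. [cite: Lange2023AbelianVarietiesComplex, §1.1.3 Cor. 1.1.19] -/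
theorem rationalForms_le_of_range_latticeVec_subset
    (h : range (latticeVec Φ') ⊆ range (latticeVec Φ)) (k : ℕ) :
    rationalForms Φ k ≤ rationalForms Φ' k := by
  intro γ hγ m'
  choose m hm using fun j ↦ h ⟨m' j, rfl⟩
  obtain ⟨q, hq⟩ := hγ m
  refine ⟨q, ?_⟩
  rw [← hq]
  congr 1
  funext j
  rw [latticeTuple_apply, latticeTuple_apply, hm j]

/-- **`Hᵏ(X, ℤ)` depends only on the lattice**: two presentations `Φ`, `Φ'` of `E` with the same lattice
`Φ(ℤ^ι) = Φ'(ℤ^{ι'})` have the same integral forms. [cite: Lange2023AbelianVarietiesComplex, §1.1.3 Lemma 1.1.17] -/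
theorem integralForms_eq_of_range_latticeVec_eq
    (h : range (latticeVec Φ) = range (latticeVec Φ')) (k : ℕ) :
    integralForms Φ k = integralForms Φ' k :=
  le_antisymm (integralForms_le_of_range_latticeVec_subset h.ge k)
    (integralForms_le_of_range_latticeVec_subset h.le k)

/-- **`Hᵏ(X, ℚ)` depends only on the lattice.** [cite: Lange2023AbelianVarietiesComplex, §1.1.3 Cor. 1.1.19] -/
theorem rationalForms_eq_of_range_latticeVec_eq
    (h : range (latticeVec Φ) = range (latticeVec Φ')) (k : ℕ) :
    rationalForms Φ k = rationalForms Φ' k :=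
  le_antisymm (rationalForms_le_of_range_latticeVec_subset h.ge k)
    (rationalForms_le_of_range_latticeVec_subset h.le k)

/-- **The Hodge classes depend only on the lattice** (rationality is lattice-only, the type `(p,p)`
condition does not involve `Φ`). [cite: Lange2023AbelianVarietiesComplex, §7.2.2] -/
theorem hodgeClassesIn_eq_of_range_latticeVec_eq
    (h : range (latticeVec Φ) = range (latticeVec Φ')) (k p : ℕ) :
    hodgeClassesIn Φ k p = hodgeClassesIn Φ' k p := by
  ext γ
  rw [mem_hodgeClassesIn_iff, mem_hodgeClassesIn_iff, rationalForms_eq_of_range_latticeVec_eq h]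

/-- `H^{2p}_Hodge(X)` depends only on the lattice. [cite: Lange2023AbelianVarietiesComplex, §7.2.2] -/
theorem hodgeClasses_eq_of_range_latticeVec_eq
    (h : range (latticeVec Φ) = range (latticeVec Φ')) (p : ℕ) :
    hodgeClasses Φ p = hodgeClasses Φ' p :=
  hodgeClassesIn_eq_of_range_latticeVec_eq h (2 * p) p

end Lattice

/-! ### Reindexing a presentation along a bijection of index types -/

section Reindex

variable {ι ι' : Type*} [Fintype ι'] {E : Type*} [NormedAddCommGroup E] [NormedSpace ℂ E]
  (Φ : (ι → ℝ) ≃L[ℝ] E) (e : ι ≃ ι')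

/-- **Reindexing the lattice basis**: the presentation `ℝ^{ι'} ≃ E`, `v ↦ Φ(v ∘ e)`, of the same torus
`E/Λ` with the same lattice basis relabelled along `e : ι ≃ ι'` (Lange 2023, §1.1.1: a period matrix is
the choice of a `ℤ`-basis of `Λ`; relabelling the basis changes nothing).
[cite: Lange2023AbelianVarietiesComplex, §1.1.1] -/
def reindex : (ι' → ℝ) ≃L[ℝ] E :=
  (LinearEquiv.funCongrLeft ℝ ℝ e).toContinuousLinearEquiv.trans Φ

/-- `reindex Φ e v = Φ (v ∘ e)`. [cite: Lange2023AbelianVarietiesComplex, §1.1.1] -/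
@[simp] theorem reindex_apply (v : ι' → ℝ) : reindex Φ e v = Φ (fun i ↦ v (e i)) := rfl

/-- The lattice vectors of the reindexed presentation: `λ'_m = λ_{m ∘ e}`.
[cite: Lange2023AbelianVarietiesComplex, §1.1.1] -/
theorem latticeVec_reindex (m : ι' → ℤ) : latticeVec (reindex Φ e) m = latticeVec Φ (m ∘ e) := rfl

/-- **Reindexing does not change the lattice.** [cite: Lange2023AbelianVarietiesComplex, §1.1.1] -/
theorem range_latticeVec_reindex : range (latticeVec (reindex Φ e)) = range (latticeVec Φ) := by
  refine Set.Subset.antisymm ?_ ?_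
  · rintro _ ⟨m, rfl⟩
    exact ⟨m ∘ e, (latticeVec_reindex Φ e m).symm⟩
  · rintro _ ⟨m, rfl⟩
    refine ⟨m ∘ e.symm, ?_⟩
    rw [latticeVec_reindex]
    congr 1
    funext i
    simp

/-- `Hᵏ(X, ℤ)` is unchanged by reindexing. [cite: Lange2023AbelianVarietiesComplex, §1.1.3 Lemma 1.1.17] -/
theorem integralForms_reindex (k : ℕ) : integralForms (reindex Φ e) k = integralForms Φ k :=
  integralForms_eq_of_range_latticeVec_eq (range_latticeVec_reindex Φ e) k

/-- `Hᵏ(X, ℚ)` is unchanged by reindexing. [cite: Lange2023AbelianVarietiesComplex, §1.1.3 Cor. 1.1.19] -/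
theorem rationalForms_reindex (k : ℕ) : rationalForms (reindex Φ e) k = rationalForms Φ k :=
  rationalForms_eq_of_range_latticeVec_eq (range_latticeVec_reindex Φ e) k

/-- The Hodge classes are unchanged by reindexing. [cite: Lange2023AbelianVarietiesComplex, §7.2.2] -/
theorem hodgeClassesIn_reindex (k p : ℕ) : hodgeClassesIn (reindex Φ e) k p = hodgeClassesIn Φ k p :=
  hodgeClassesIn_eq_of_range_latticeVec_eq (range_latticeVec_reindex Φ e) k p

/-- `H^{2p}_Hodge(X)` is unchanged by reindexing. [cite: Lange2023AbelianVarietiesComplex, §7.2.2] -/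
theorem hodgeClasses_reindex (p : ℕ) : hodgeClasses (reindex Φ e) p = hodgeClasses Φ p :=
  hodgeClasses_eq_of_range_latticeVec_eq (range_latticeVec_reindex Φ e) p

/-! ### The permutation matrices between the two presentations have trivial analytic representation -/

variable [Fintype ι] [DecidableEq ι']

/-- The permutation matrix `P ∈ M(ι' × ι, ℤ)` of `e`, `P e_i = e_{e i}` (rational representation of the
identity of `E/Λ` from the `Φ`-coordinates to the reindexed coordinates).
[cite: Lange2023AbelianVarietiesComplex, §1.1.2] -/
def reindexMatrix : Matrix ι' ι ℤ := Matrix.of fun j i ↦ if e i = j then 1 else 0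

/-- The inverse permutation matrix `Q ∈ M(ι × ι', ℤ)`, `Q e_{e i} = e_i`.
[cite: Lange2023AbelianVarietiesComplex, §1.1.2] -/
def reindexMatrixInv : Matrix ι ι' ℤ := Matrix.of fun i j ↦ if e i = j then 1 else 0

omit [Fintype ι'] in
/-- `P x` has `e i`-th coordinate `x i`: `(P_ℝ x) j = x (e⁻¹ j)`. [cite: Lange2023AbelianVarietiesComplex, §1.1.2] -/
theorem reindexMatrix_mulVec (x : ι → ℝ) (j : ι') :
    ((reindexMatrix e).map (Int.cast : ℤ → ℝ)).mulVec x j = x (e.symm j) := by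
  simp only [Matrix.mulVec, dotProduct, Matrix.map_apply, reindexMatrix, Matrix.of_apply]
  rw [Finset.sum_eq_single (e.symm j)]
  · simp
  · intro i _ hi
    have h : e i ≠ j := fun h ↦ hi (by rw [← h, Equiv.symm_apply_apply])
    simp [h]
  · exact fun h ↦ absurd (Finset.mem_univ _) h

omit [Fintype ι] in
/-- `(Q_ℝ v) i = v (e i)`. [cite: Lange2023AbelianVarietiesComplex, §1.1.2] -/
theorem reindexMatrixInv_mulVec (v : ι' → ℝ) (i : ι) :
    ((reindexMatrixInv e).map (Int.cast : ℤ → ℝ)).mulVec v i = v (e i) := by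
  simp only [Matrix.mulVec, dotProduct, Matrix.map_apply, reindexMatrixInv, Matrix.of_apply]
  rw [Finset.sum_eq_single (e i)]
  · simp
  · intro j _ hj
    simp [Ne.symm hj]
  · exact fun h ↦ absurd (Finset.mem_univ _) h

/-- **The identity of `E/Λ` between the two presentations has analytic representation `id`**:
`ρ(P) = reindex Φ e ∘ P_ℝ ∘ Φ⁻¹ = id_E`. [cite: Lange2023AbelianVarietiesComplex, §1.1.2] -/
theorem realRep_reindexMatrix : realRep Φ (reindex Φ e) (reindexMatrix e) = ContinuousLinearMap.id ℝ E := by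
  refine ContinuousLinearMap.ext fun z ↦ ?_
  obtain ⟨x, rfl⟩ : ∃ x, Φ x = z := ⟨Φ.symm z, Φ.apply_symm_apply z⟩
  rw [realRep_apply, ContinuousLinearMap.id_apply, reindex_apply]
  congr 1
  funext i
  rw [reindexMatrix_mulVec, Equiv.symm_apply_apply]

omit [Fintype ι] in
/-- The inverse direction: `ρ(Q) = Φ ∘ Q_ℝ ∘ (reindex Φ e)⁻¹ = id_E`. [cite: Lange2023AbelianVarietiesComplex, §1.1.2] -/
theorem realRep_reindexMatrixInv :
    realRep (reindex Φ e) Φ (reindexMatrixInv e) = ContinuousLinearMap.id ℝ E := by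
  refine ContinuousLinearMap.ext fun z ↦ ?_
  obtain ⟨v, rfl⟩ : ∃ v, reindex Φ e v = z := ⟨(reindex Φ e).symm z, (reindex Φ e).apply_symm_apply z⟩
  rw [realRep_apply, ContinuousLinearMap.id_apply, reindex_apply]
  congr 1
  funext i
  rw [reindexMatrixInv_mulVec]

end Reindex

end ComplexTorus

end Literature.Geometry.Kaehler

end
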